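import Summits.CriticalPhenomena.PercolationContinuityZ3.Theorems.Transplant.SqShadowGluing
import Summits.CriticalPhenomena.PercolationContinuityZ3.Theorems.Transplant.HexShadowGlueEvents
import HarnessLib

/-!
# SQUARE SHADOWS XII — the objects of DST §2.3 in square geometry: the range of the Gluing Lemma's data, the event `𝒳`, the minimal path `γ_min`, its columns, the set
# `U(ω)`; FACTS 1 and 2 as nodes and **the Gluing Lemma `SqGluing` from the two facts**

builds on p205010 (kernel theorem, internal audit signed; external expert review pending) — NOT used in this file.
Lane `prim-bschramm`, seat `prim-bschramm-p2` (gen 42; class C1b; memo `HOME/bschramm/P2-LATTICES.md` §148); helper file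
(`--supports stmt-CriticalPhenomena-4575 --as helper`).  Hexagonal twin «HexShadowGlueEvents» (whose data record `GlueData = (m, u₃, u₁, a, s)` is reused, `m` being DST's scale `n`);
generic tools «HexShadowGammaMin» (`OpenSAP`, `minSAP`); slab original `Literature/…/SlabGluing` §"GlueEvents"/"Facts".
* §1 the range `SqShadow.InRange Ψ D` (that of `SqGluing`: `period ∣ m`, `4u₃ ≤ 3m`, `4u₁ ≤ m`, `1 ≤ a ≤ m − 1`, `period·s ∈ [0, 3m]`); the shadow sets `big = sqBall c 3m`
  (`B_{3n}`), `small = sqBall c' m` (`B'_n`), `src`, `src'`, `zSeg`, and the event `evX = A ∩ B⁻ ∩ B⁺ ∩ Cᶜ` (the events of «SqShadowGluing»);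
* §2 `γmin D ω` (the minimal open self-avoiding path from `\overline{src}` to `\overline{zSeg}` inside `\overline{big}`), its columns `γcols ⊆ ℤ²`, **the set `U(ω)`** (points `z` of
  `small` on a column of `γ_min` such that some vertex over the unit square `sqBall z 1` is joined to `\overline{src'}` inside `\overline{small}` OFF the columns of `γ_min` —
  DST's (P1)–(P2)), finiteness, window properties;
* §3 the nodes **`SqFact1`**, **`SqFact2`** (internal obligations, never asserted) and **`sqGluing_of_facts : SqFact1 → SqFact2 → SqGluing`** PROVED.
[cite: DuminilCopinSidoraviciusTassion2016, Lemma 6 and §2.3 (𝒳, γ_min, U(ω), Facts 1–2, p. 7)]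
-/

noncomputable section

namespace Summit.CriticalPhenomena.PercolationContinuityZ3.Theorems.Transplant

open MeasureTheory Literature.Probability.Percolation Literature.Probability.LatticeModels SimpleGraph Filter
open scoped Classical Topology

/-! ## §1 The data, the sets and the event `𝒳` -/

namespace SqShadow

variable {V : Type} {G : SimpleGraph V} (Ψ : SqShadow G)

/-- **The range of the data** (that of `SqGluing`, scale `m = n`): `period ∣ m`, `4u₃ ≤ 3m` (no touching), `4u₁ ≤ m`, `1 ≤ a ≤ m − 1`, `period·s ∈ [0, 3m]`.  A predicate on
the data, the standing hypothesis of Facts 1–2. [cite: DuminilCopinSidoraviciusTassion2016, Lemma 6] -/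
def InRange (D : GlueData) : Prop :=
  Ψ.period ∣ D.m ∧ 4 * D.u₃ ≤ 3 * D.m ∧ 4 * D.u₁ ≤ D.m ∧ 1 ≤ D.a ∧ D.a + 1 ≤ D.m ∧ 0 ≤ (Ψ.period : ℤ) * D.s ∧ (Ψ.period : ℤ) * D.s ≤ 3 * D.m

/-- `H₃ = sqBall c 3m` (DST's `B_{3n}`, `m = n`). [cite: DuminilCopinSidoraviciusTassion2016, §2.1 (p. 5)] -/
def big (D : GlueData) : Set (Site 2) := sqBall Ψ.centre (3 * D.m)

/-- `B' = sqBall c' m` (DST's `B'_n`). [cite: DuminilCopinSidoraviciusTassion2016, §2.1 (p. 5)] -/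
def small (D : GlueData) : Set (Site 2) := sqBall (Ψ.glueCentre D.m D.s) D.m

/-- `S₃ = sqBall c u₃` (DST's `S_{3n}`). [cite: DuminilCopinSidoraviciusTassion2016, §2.1 (p. 5)] -/
def src (D : GlueData) : Set (Site 2) := sqBall Ψ.centre D.u₃

/-- `S' = sqBall c' u₁` (DST's `S'_n`). [cite: DuminilCopinSidoraviciusTassion2016, §2.1 (p. 5)] -/
def src' (D : GlueData) : Set (Site 2) := sqBall (Ψ.glueCentre D.m D.s) D.u₁

/-- `Z = sqSide c' m (−a) a` (DST's `Z_n`). [cite: DuminilCopinSidoraviciusTassion2016, §2.1 (p. 5)] -/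
def zSeg (D : GlueData) : Set (Site 2) := sqSide (Ψ.glueCentre D.m D.s) D.m (-(D.a : ℤ)) D.a

/-- **`𝒳 = A ∩ B⁻ ∩ B⁺ ∩ Cᶜ`** (DST §2.3, p. 6). [cite: DuminilCopinSidoraviciusTassion2016, §2.3 (p. 6, the event 𝒳)] -/
def evX (D : GlueData) : Set (BondConfig V) :=
  Ψ.glueA D.m D.u₃ D.a D.s ∩ Ψ.glueBm D.m D.u₁ D.a D.s ∩ Ψ.glueBp D.m D.u₁ D.a D.s ∩ (Ψ.glueC D.m D.u₃ D.u₁ D.s)ᶜ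

/-- `A` is the crossing `src ⟷^{big} zSeg`. [folklore] -/
theorem glueA_eq (D : GlueData) : Ψ.glueA D.m D.u₃ D.a D.s = Ψ.conn (Ψ.big D) (Ψ.src D) (Ψ.zSeg D) := rfl

/-- `C` is the crossing `src ⟷^{big ∪ small} src'`. [folklore] -/
theorem glueC_eq (D : GlueData) : Ψ.glueC D.m D.u₃ D.u₁ D.s = Ψ.conn (Ψ.big D ∪ Ψ.small D) (Ψ.src D) (Ψ.src' D) := rfl

/-- `\overline{big}` is finite. [folklore] -/
theorem lift_big_finite (D : GlueData) : (Ψ.lift (Ψ.big D)).Finite := Ψ.lift_finite (sqBall_finite _ _)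

/-- `\overline{big ∪ small}` is finite. [folklore] -/
theorem lift_window_finite (D : GlueData) : (Ψ.lift (Ψ.big D ∪ Ψ.small D)).Finite :=
  Ψ.lift_finite ((sqBall_finite _ _).union (sqBall_finite _ _))

/-! ## §2 The minimal path, its columns, the set `U(ω)` -/

variable [Countable V]

/-- **`γ_min(ω)`**: the minimal open self-avoiding path from `\overline{src}` to `\overline{zSeg}` inside `\overline{big}`.
[cite: DuminilCopinSidoraviciusTassion2016, §2.3 (Definition of γ_min)] -/
def γmin (D : GlueData) (ω : BondConfig V) : List V := minSAP ω (Ψ.lift (Ψ.big D)) (Ψ.lift (Ψ.src D)) (Ψ.lift (Ψ.zSeg D))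

/-- The columns of `γ_min(ω)`: its shadow in `𝕋`. [cite: DuminilCopinSidoraviciusTassion2016, §2.3 (P1, P2)] -/
def γcols (D : GlueData) (ω : BondConfig V) : Set (Site 2) := {z | ∃ x ∈ Ψ.γmin D ω, Ψ.sh x = z}

/-- **The set `U(ω)`** (DST §2.3, Definition, p. 6): the points `z` of `small` such that (P1) the column of `z` meets `γ_min(ω)` and (P2) some vertex over the
unit square `sqBall z 1` is joined to `\overline{src'}` by an open path inside `\overline{small}` all of whose vertices lie OFF the columns of `γ_min(ω)`
(so that the shadow of the path is at sup-distance at most `1` from that of `γ_min`). [cite: DuminilCopinSidoraviciusTassion2016, §2.3 (Definition of U(ω), p. 6)] -/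
def U (D : GlueData) (ω : BondConfig V) : Set (Site 2) :=
  {z | z ∈ Ψ.small D ∧ z ∈ Ψ.γcols D ω ∧
    ∃ x₀ : V, Ψ.sh x₀ ∈ sqBall z 1 ∧ ∃ s' ∈ Ψ.lift (Ψ.src' D), ω ∈ openConnIn (Ψ.lift (Ψ.small D) ∩ {v | Ψ.sh v ∉ Ψ.γcols D ω}) x₀ s'}

/-- `U(ω)` lies in the columns of `γ_min(ω)`. [folklore] -/
theorem U_subset_γcols (D : GlueData) (ω : BondConfig V) : Ψ.U D ω ⊆ Ψ.γcols D ω := fun _ h => h.2.1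

/-- The columns of `γ_min` form a finite set. [folklore] -/
theorem γcols_finite (D : GlueData) (ω : BondConfig V) : (Ψ.γcols D ω).Finite := by
  have : Ψ.γcols D ω = Ψ.sh '' {x | x ∈ Ψ.γmin D ω} := by ext z; simp [γcols]
  rw [this]
  exact (List.finite_toSet _).image _

/-- `U(ω)` is finite. [folklore] -/
theorem U_finite (D : GlueData) (ω : BondConfig V) : (Ψ.U D ω).Finite := (Ψ.γcols_finite D ω).subset (Ψ.U_subset_γcols D ω)

/-- On `A`, `γ_min` is an open self-avoiding path from `\overline{src}` to `\overline{zSeg}` inside `\overline{big}`, of least key.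
[cite: DuminilCopinSidoraviciusTassion2016, §2.3 (Definition of γ_min)] -/
theorem γmin_spec (D : GlueData) {ω : BondConfig V} (hA : ω ∈ Ψ.glueA D.m D.u₃ D.a D.s) :
    OpenSAP ω (Ψ.lift (Ψ.big D)) (Ψ.lift (Ψ.src D)) (Ψ.lift (Ψ.zSeg D)) (Ψ.γmin D ω) ∧
      ∀ l, OpenSAP ω (Ψ.lift (Ψ.big D)) (Ψ.lift (Ψ.src D)) (Ψ.lift (Ψ.zSeg D)) l → sapKey (Ψ.γmin D ω) ≤ sapKey l :=
  minSAP_spec (Ψ.lift_big_finite D) ((mem_openCrossing_iff_exists_openSAP ω _ _ _).1 hA)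

/-- Configurations agreeing on the pairs over the window `big ∪ small` have the same `γ_min`. [folklore] -/
theorem γmin_congr (D : GlueData) {ω ω' : BondConfig V} (h : ∀ e ∈ (Ψ.lift (Ψ.big D ∪ Ψ.small D)).sym2, e ∈ ω ↔ e ∈ ω') :
    Ψ.γmin D ω = Ψ.γmin D ω' :=
  minSAP_congr (Ψ.lift_big_finite D) fun e he => h e (by
    rw [Set.mem_sym2_iff_subset] at he ⊢; exact he.trans (Ψ.lift_mono Set.subset_union_left))

/-- Configurations agreeing on the pairs over the window have the same `U`. [folklore] -/
theorem U_congr (D : GlueData) {ω ω' : BondConfig V} (h : ∀ e ∈ (Ψ.lift (Ψ.big D ∪ Ψ.small D)).sym2, e ∈ ω ↔ e ∈ ω') : Ψ.U D ω = Ψ.U D ω' := by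
  have hcols : Ψ.γcols D ω = Ψ.γcols D ω' := by simp only [γcols, Ψ.γmin_congr D h]
  ext z
  simp only [U, Set.mem_setOf_eq, hcols]
  refine and_congr_right fun _ => and_congr_right fun _ => ?_
  refine exists_congr fun x₀ => and_congr_right fun _ => exists_congr fun s' => and_congr_right fun _ => ?_
  exact openConnIn_congr (fun e he => h e (by
    rw [Set.mem_sym2_iff_subset] at he ⊢
    exact he.trans (Set.inter_subset_left.trans (Ψ.lift_mono Set.subset_union_right)))) x₀ s'

omit [Countable V] in
/-- The crossings `X ⟷^B Y` with `B ⊆ big ∪ small` only depend on the window. [folklore] -/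
theorem mem_conn_congr (D : GlueData) {ω ω' : BondConfig V} (h : ∀ e ∈ (Ψ.lift (Ψ.big D ∪ Ψ.small D)).sym2, e ∈ ω ↔ e ∈ ω') {B : Set (Site 2)}
    (hB : B ⊆ Ψ.big D ∪ Ψ.small D) (X Y : Set (Site 2)) : ω ∈ Ψ.conn B X Y ↔ ω' ∈ Ψ.conn B X Y := by
  have hd := Ψ.determinedBy_conn X Y hB
  rw [determinedBy_iff] at hd
  exact hd ω ω' (Set.ext fun e => ⟨fun he => ⟨(h e he.2).1 he.1, he.2⟩, fun he => ⟨(h e he.2).2 he.1, he.2⟩⟩)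

omit [Countable V] in
/-- `𝒳` only depends on the window. [folklore] -/
theorem mem_evX_congr (D : GlueData) {ω ω' : BondConfig V} (h : ∀ e ∈ (Ψ.lift (Ψ.big D ∪ Ψ.small D)).sym2, e ∈ ω ↔ e ∈ ω') :
    ω ∈ Ψ.evX D ↔ ω' ∈ Ψ.evX D := by
  have hA : ω ∈ Ψ.glueA D.m D.u₃ D.a D.s ↔ ω' ∈ Ψ.glueA D.m D.u₃ D.a D.s :=
    Ψ.mem_conn_congr D h (B := Ψ.big D) Set.subset_union_left (Ψ.src D) (Ψ.zSeg D)
  have hBm : ω ∈ Ψ.glueBm D.m D.u₁ D.a D.s ↔ ω' ∈ Ψ.glueBm D.m D.u₁ D.a D.s :=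
    Ψ.mem_conn_congr D h (B := Ψ.small D) Set.subset_union_right (Ψ.src' D) (sqSide (Ψ.glueCentre D.m D.s) D.m (-(D.m : ℤ)) (-(D.a : ℤ)))
  have hBp : ω ∈ Ψ.glueBp D.m D.u₁ D.a D.s ↔ ω' ∈ Ψ.glueBp D.m D.u₁ D.a D.s :=
    Ψ.mem_conn_congr D h (B := Ψ.small D) Set.subset_union_right (Ψ.src' D) (sqSide (Ψ.glueCentre D.m D.s) D.m D.a D.m)
  have hC : ω ∈ Ψ.glueC D.m D.u₃ D.u₁ D.s ↔ ω' ∈ Ψ.glueC D.m D.u₃ D.u₁ D.s :=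
    Ψ.mem_conn_congr D h (B := Ψ.big D ∪ Ψ.small D) subset_rfl (Ψ.src D) (Ψ.src' D)
  simp only [evX, Set.mem_inter_iff, Set.mem_compl_iff, hA, hBm, hBp, hC]

/-! ## §3 Facts 1 and 2 as nodes; the Gluing Lemma from them -/

/-- **NODE — DST §2.3, FACT 1, in square geometry** (the form its proof gives, with an unspecified constant): for `0 < p < 1` and every `t` there is `L`
(depending on `t`, `p`, the graph, NOT on the data) with `P_p[𝒳 ∩ {|U| < t}] ≤ L · P_p[(B⁻ ∩ B⁺)ᶜ]` for all data in range.  (Lemma 7 applied to the map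
closing the edges at the columns of `U(ω)` whose other endpoint is joined to `\overline{src'}`; the planar crossing fact for `ℤ²`-walks.)  Internal obligation,
never asserted. [cite: DuminilCopinSidoraviciusTassion2016, §2.3 (Fact 1, p. 6)] -/
def SqFact1 {V : Type} {G : SimpleGraph V} (Ψ : SqShadow G) [Countable V] : Prop :=
  ∀ p : unitInterval, 0 < (p : ℝ) → (p : ℝ) < 1 → ∀ t : ℕ, ∃ L : ℝ, ∀ D : GlueData, Ψ.InRange D →
    (bondPercolation G p).real (Ψ.evX D ∩ {ω | (Ψ.U D ω).ncard < t}) ≤ L * (bondPercolation G p).real (Ψ.glueBm D.m D.u₁ D.a D.s ∩ Ψ.glueBp D.m D.u₁ D.a D.s)ᶜ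

/-- **NODE — DST §2.3, FACT 2, in square geometry**: for `0 < p < 1` and every `ε > 0` there are `t` and a scale `m₀` such that
`P_p[𝒳 ∩ {|U| ≥ t}] ≤ ε · P_p[C]` for all data in range with `m ≥ m₀` (Lemma 7 applied to the local surgeries `ω ↦ {ω^{(z)} : z ∈ U(ω)}`; needs three
disjoint paths in a column block of the instance).  Internal obligation, never asserted. [cite: DuminilCopinSidoraviciusTassion2016, §2.3 (Fact 2, pp. 6–7)] -/
def SqFact2 {V : Type} {G : SimpleGraph V} (Ψ : SqShadow G) [Countable V] : Prop :=
  ∀ p : unitInterval, 0 < (p : ℝ) → (p : ℝ) < 1 → ∀ ε : ℝ, 0 < ε → ∃ t : ℕ, ∃ m₀ : ℕ, ∀ D : GlueData, m₀ ≤ D.m → Ψ.InRange D →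
    (bondPercolation G p).real (Ψ.evX D ∩ {ω | t ≤ (Ψ.U D ω).ncard}) ≤ ε * (bondPercolation G p).real (Ψ.glueC D.m D.u₃ D.u₁ D.s)

/-- `𝒳` splits along `|U| < t` / `|U| ≥ t`. [folklore] -/
theorem real_evX_le (D : GlueData) (p : unitInterval) (t : ℕ) :
    (bondPercolation G p).real (Ψ.evX D) ≤
      (bondPercolation G p).real (Ψ.evX D ∩ {ω | (Ψ.U D ω).ncard < t}) + (bondPercolation G p).real (Ψ.evX D ∩ {ω | t ≤ (Ψ.U D ω).ncard}) := by
  have : Ψ.evX D ⊆ (Ψ.evX D ∩ {ω | (Ψ.U D ω).ncard < t}) ∪ (Ψ.evX D ∩ {ω | t ≤ (Ψ.U D ω).ncard}) := by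
    intro ω hω
    by_cases h : (Ψ.U D ω).ncard < t
    · exact Or.inl ⟨hω, h⟩
    · exact Or.inr ⟨hω, not_lt.1 h⟩
  exact (measureReal_mono this).trans (measureReal_union_le _ _)

omit [Countable V] in
/-- `{A, B⁻, B⁺} ⊆ C ∪ 𝒳`. [folklore] -/
theorem real_triple_le (D : GlueData) (p : unitInterval) :
    (bondPercolation G p).real (Ψ.glueA D.m D.u₃ D.a D.s ∩ Ψ.glueBm D.m D.u₁ D.a D.s ∩ Ψ.glueBp D.m D.u₁ D.a D.s) ≤
      (bondPercolation G p).real (Ψ.glueC D.m D.u₃ D.u₁ D.s) + (bondPercolation G p).real (Ψ.evX D) := by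
  have : Ψ.glueA D.m D.u₃ D.a D.s ∩ Ψ.glueBm D.m D.u₁ D.a D.s ∩ Ψ.glueBp D.m D.u₁ D.a D.s ⊆ Ψ.glueC D.m D.u₃ D.u₁ D.s ∪ Ψ.evX D := by
    intro ω hω
    by_cases hC : ω ∈ Ψ.glueC D.m D.u₃ D.u₁ D.s
    · exact Or.inl hC
    · exact Or.inr ⟨hω, hC⟩
  exact (measureReal_mono this).trans (measureReal_union_le _ _)

omit [Countable V] in
/-- `B⁻ ∩ B⁺` is measurable. [folklore] -/
theorem measurableSet_glueB (D : GlueData) : MeasurableSet (Ψ.glueBm D.m D.u₁ D.a D.s ∩ Ψ.glueBp D.m D.u₁ D.a D.s) :=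
  (Ψ.measurableSet_sideEvent _ _ _ _ _).inter (Ψ.measurableSet_sideEvent _ _ _ _ _)

/-- **THE GLUING LEMMA FROM FACTS 1 AND 2** ("Fix `ε > 0`. Choosing first `t` as in Fact 2 and then `δ` as in Fact 1 conclude the proof of Lemma 6",
DST §2.3, p. 7): given `ε`, take `t, m₀` as in Fact 2 for `ε/2`, `L` as in Fact 1 for `t`, and `δ (1 + L) = ε/2`; then `P[𝒳] ≤ Lδ + (ε/2) P[C]` and
`P[C] ≥ P[A ∩ B⁻ ∩ B⁺] − P[𝒳] ≥ 1 − ε`. [cite: DuminilCopinSidoraviciusTassion2016, §2.3 (p. 7, conclusion of the proof of Lemma 6)] -/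
theorem sqGluing_of_facts (h1 : Ψ.SqFact1) (h2 : Ψ.SqFact2) : Ψ.SqGluing := by
  intro v p hθ hp1 ε hε
  have hp0 : 0 < (p : ℝ) := HexShadow.coe_pos_of_theta_pos hθ
  obtain ⟨t, m₀, ht⟩ := h2 p hp0 hp1 (ε / 2) (half_pos hε)
  obtain ⟨L₀, hL₀⟩ := h1 p hp0 hp1 t
  set L : ℝ := max L₀ 1 with hL
  have hL1 : 1 ≤ L := le_max_right _ _
  refine ⟨ε / (2 * (1 + L)), by positivity, m₀, fun m u₃ u₁ a s hm₀ hdvd hu₃ hu₁ ha1 ham hs1 hs2 hP => ?_⟩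
  set D : GlueData := ⟨m, u₃, u₁, a, s⟩ with hD
  have hrange : Ψ.InRange D := ⟨hdvd, hu₃, hu₁, ha1, ham, hs1, hs2⟩
  set P := bondPercolation G p with hPdef
  have hF1 : P.real (Ψ.evX D ∩ {ω | (Ψ.U D ω).ncard < t}) ≤ L * P.real (Ψ.glueBm m u₁ a s ∩ Ψ.glueBp m u₁ a s)ᶜ :=
    (hL₀ D hrange).trans (mul_le_mul_of_nonneg_right (le_max_left _ _) measureReal_nonneg)
  have hF2 : P.real (Ψ.evX D ∩ {ω | t ≤ (Ψ.U D ω).ncard}) ≤ ε / 2 * P.real (Ψ.glueC m u₃ u₁ s) := ht D hm₀ hrange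
  have hX := Ψ.real_evX_le D p t
  have hT := Ψ.real_triple_le D p
  have hB : P.real (Ψ.glueBm m u₁ a s ∩ Ψ.glueBp m u₁ a s)ᶜ ≤ ε / (2 * (1 + L)) := by
    rw [measureReal_compl (Ψ.measurableSet_glueB D), probReal_univ]
    have : P.real (Ψ.glueA m u₃ a s ∩ Ψ.glueBm m u₁ a s ∩ Ψ.glueBp m u₁ a s) ≤ P.real (Ψ.glueBm m u₁ a s ∩ Ψ.glueBp m u₁ a s) :=
      measureReal_mono (by rw [Set.inter_assoc]; exact Set.inter_subset_right)
    change 1 - P.real (Ψ.glueBm m u₁ a s ∩ Ψ.glueBp m u₁ a s) ≤ ε / (2 * (1 + L))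
    linarith
  have hC1 : P.real (Ψ.glueC m u₃ u₁ s) ≤ 1 := measureReal_le_one
  have hC0 : 0 ≤ P.real (Ψ.glueC m u₃ u₁ s) := measureReal_nonneg
  have hεC : ε / 2 * P.real (Ψ.glueC m u₃ u₁ s) ≤ ε / 2 := by
    have := mul_le_mul_of_nonneg_left hC1 (half_pos hε).le
    simpa using this
  have hLB : L * P.real (Ψ.glueBm m u₁ a s ∩ Ψ.glueBp m u₁ a s)ᶜ ≤ L * (ε / (2 * (1 + L))) := mul_le_mul_of_nonneg_left hB (by positivity)
  have hsum : L * (ε / (2 * (1 + L))) + ε / (2 * (1 + L)) = ε / 2 := by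
    field_simp
    ring
  have hXD : P.real (Ψ.evX D) = P.real (Ψ.evX ⟨m, u₃, u₁, a, s⟩) := rfl
  nlinarith [hP, hF1, hF2, hX, hT, hB, hLB, hsum, hεC]

end SqShadow

end Summit.CriticalPhenomena.PercolationContinuityZ3.Theorems.Transplant

end
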